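import Summits.AtomisticToContinuum.Crystallization.Theorems.PalmUnimodularRigidityLayeredLawsSelectHcpRelaxedReference

/-!
# The relaxed hcp reference with its ratio enclosure
(stub S0 `stub_relaxedRatio` of line `palm-good-law`, crux `ReggeStarCoercivity.DefectFreeCrystallizes`,
stmt-AtomisticToContinuum-13603)

**Theorem** (`stub_relaxedRatio`).  The total hcp energy function
`hcpE a h = ½ ∑_{v ≠ 0} V_LJ(√(a² Q v + k² h²))` attains its global minimum over the open quadrant
`{a > 0, h > 0}` at a point `(a₁, h₁)` with `a₁ ∈ [0.945, 0.995]` AND the ratio enclosure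
`39/50 · a₁ ≤ h₁ ≤ 17/20 · a₁` (so `(a₁, h₁)` lies in the registry box of item 3063).

**Proof.**  Verbatim the landed `LayeredLawsSelectHcp.stub_relaxedReference`
(`…PalmUnimodularRigidityLayeredLawsSelectHcpRelaxedReference`): the shape function `F = S₃²/S₆` of the
certified lattice sums is continuous on `(0, ∞)` (`continuousOn_shape`) and so has a maximiser `c₀` on the
compact box `[39/50, 17/20]` (`IsCompact.exists_isMaxOn`); outside the box
`F ≤ 14.457431022²/12.138038647 ≤ F(0.8164) ≤ F(c₀)` (`stub_relaxedReferenceExclusion`, `hcpSum_grid_8164`),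
so `c₀` is a global maximiser of `F` on `(0, ∞)`.  Put `a₁ = (S₆(c₀)/S₃(c₀))^{1/6}` and `h₁ = a₁ c₀`.  The
pin numerics `hcpSum_main` give `a₁⁶ ∈ [0.945⁶, 0.995⁶]`, i.e. `a₁ ∈ [0.945, 0.995]`; the ratio enclosure is
`c₀ ∈ [39/50, 17/20]` multiplied by `a₁ > 0`; and global minimality is the dilation parabola
`hcpE a (a c) ≥ −F(c)/24 ≥ −F(c₀)/24 = hcpE a₁ h₁` (`hcpE_ge_shape`, `hcpPinC_dilation_value`).
All `[folklore]`.
-/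

noncomputable section

namespace Summit.AtomisticToContinuum.Crystallization.Theorems.PalmGoodLaw.RelaxedRatio

open MeasureTheory Set
open Literature.MathematicalPhysics.StatisticalMechanics Literature.Geometry.DiscreteGeometry
open Summit.AtomisticToContinuum.Crystallization.Theorems.ExcessDecayLiouvilleCoarseGrains
open Summit.AtomisticToContinuum.Crystallization.Theorems.PalmUnimodularRigidity.LayeredLawsSelectHcp

/-- **Stub S0 `stub_relaxedRatio` of line `palm-good-law` (crux `ReggeStarCoercivity.DefectFreeCrystallizes`,
stmt-AtomisticToContinuum-13603): THE RELAXED hcp REFERENCE WITH ITS RATIO ENCLOSURE.**  The total energy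
function `hcpE` has a global minimiser `(a₁, h₁)` over the open quadrant with `a₁ ∈ [0.945, 0.995]` and
`39/50 · a₁ ≤ h₁ ≤ 17/20 · a₁`: the maximiser `c₀ ∈ [39/50, 17/20]` of the shape function `S₃²/S₆`
(compactness + the certified exclusion outside the box), `a₁⁶ = S₆(c₀)/S₃(c₀)`, `h₁ = a₁ c₀`, and the
landed pin numerics `hcpSum_main`. [folklore] -/
theorem stub_relaxedRatio :
    ∃ a₁ h₁ : ℝ, 189 / 200 ≤ a₁ ∧ a₁ ≤ 199 / 200 ∧ 39 / 50 * a₁ ≤ h₁ ∧ h₁ ≤ 17 / 20 * a₁ ∧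
      ∀ a h : ℝ, 0 < a → 0 < h →
        Summit.AtomisticToContinuum.Crystallization.Theorems.PalmUnimodularRigidity.LayeredLawsSelectHcp.hcpE a₁ h₁ ≤
          Summit.AtomisticToContinuum.Crystallization.Theorems.PalmUnimodularRigidity.LayeredLawsSelectHcp.hcpE a h := by
  -- adapted from …PalmUnimodularRigidityLayeredLawsSelectHcpRelaxedReference.stub_relaxedReference
  -- the shape function and a maximiser on the box
  set F : ℝ → ℝ := fun c => hcpSumS 3 c ^ 2 / hcpSumS 6 c with hF
  have hcont : ContinuousOn F (Set.Icc (39 / 50) (17 / 20)) :=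
    continuousOn_shape.mono fun c hc => lt_of_lt_of_le (by norm_num) hc.1
  obtain ⟨c₀, hc₀, hmax⟩ :=
    (isCompact_Icc : IsCompact (Set.Icc (39 / 50 : ℝ) (17 / 20))).exists_isMaxOn
      (Set.nonempty_Icc.2 (by norm_num)) hcont
  have hc₀pos : 0 < c₀ := lt_of_lt_of_le (by norm_num) hc₀.1
  have hbox : ∀ c', 39 / 50 ≤ c' → c' ≤ 17 / 20 → F c' ≤ F c₀ := fun c' h1 h2 => hmax ⟨h1, h2⟩
  -- global maximality of the shape function at `c₀`
  have hFle : ∀ c, 0 < c → F c ≤ F c₀ := by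
    intro c hc
    by_cases hin : 39 / 50 ≤ c ∧ c ≤ 17 / 20
    · exact hbox c hin.1 hin.2
    · have hout : c ≤ 39 / 50 ∨ 17 / 20 ≤ c := by
        rcases not_and_or.1 hin with h | h
        · exact Or.inl (le_of_lt (not_le.1 h))
        · exact Or.inr (le_of_lt (not_le.1 h))
      have hex := stub_relaxedReferenceExclusion c hc hout
      have h6 := hcpSumS_pos' (by norm_num : 3 ≤ 6) hc
      have hFc : F c ≤ 14.457431022 ^ 2 / 12.138038647 := by
        simp only [hF]
        rw [div_le_div_iff₀ h6 (by norm_num)]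
        linarith
      obtain ⟨g1, -, -, g4⟩ := hcpSum_grid_8164
      have h6' := hcpSumS_pos' (by norm_num : 3 ≤ 6) (show (0 : ℝ) < (8164 : ℝ) / 10000 by norm_num)
      have hFc' : 14.457431022 ^ 2 / 12.138038647 ≤ F ((8164 : ℝ) / 10000) := by
        simp only [hF]
        rw [div_le_div_iff₀ (by norm_num) h6']
        have hsq : (14.457431022 : ℝ) ^ 2 ≤ hcpSumS 3 ((8164 : ℝ) / 10000) ^ 2 :=
          pow_le_pow_left₀ (by norm_num) g1 2
        nlinarith
      exact hFc.trans (hFc'.trans (hbox _ (by norm_num) (by norm_num)))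
  -- the pin numerics at `c₀`
  obtain ⟨hb1, hb2, -, -⟩ := hcpSum_main c₀ hc₀.1 hc₀.2 hbox
  have hS3 := hcpSumS_pos' (le_refl 3) hc₀pos
  have hS6 := hcpSumS_pos' (by norm_num : 3 ≤ 6) hc₀pos
  have hq : 0 < hcpSumS 6 c₀ / hcpSumS 3 c₀ := div_pos hS6 hS3
  obtain ⟨a₀, ha₀, ha6⟩ : ∃ b : ℝ, 0 < b ∧ b ^ 6 = hcpSumS 6 c₀ / hcpSumS 3 c₀ :=
    ⟨(hcpSumS 6 c₀ / hcpSumS 3 c₀) ^ ((6 : ℕ) : ℝ)⁻¹, Real.rpow_pos_of_pos hq _,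
      Real.rpow_inv_natCast_pow hq.le (by norm_num)⟩
  rw [← ha6] at hb1 hb2
  have h6ne : (6 : ℕ) ≠ 0 := by norm_num
  refine ⟨a₀, a₀ * c₀, ?_, ?_, ?_, ?_, ?_⟩
  · exact (pow_le_pow_iff_left₀ (by norm_num) ha₀.le h6ne).1 hb1
  · exact (pow_le_pow_iff_left₀ ha₀.le (by norm_num) h6ne).1 hb2
  · -- the ratio enclosure, lower: `39/50 · a₀ ≤ a₀ · c₀` from `39/50 ≤ c₀` and `0 ≤ a₀`
    rw [mul_comm]
    exact mul_le_mul_of_nonneg_left hc₀.1 ha₀.le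
  · -- the ratio enclosure, upper: `a₀ · c₀ ≤ 17/20 · a₀` from `c₀ ≤ 17/20` and `0 ≤ a₀`
    rw [mul_comm (17 / 20 : ℝ)]
    exact mul_le_mul_of_nonneg_left hc₀.2 ha₀.le
  · intro a h ha hh
    obtain ⟨c, rfl⟩ : ∃ c, h = a * c := ⟨h / a, by field_simp⟩
    have hc : 0 < c := pos_of_mul_pos_right hh ha.le
    rw [hcpE_eq_hcpSumS ha₀.ne' hc₀pos.ne', hcpPinC_dilation_value hS3 hS6 ha6]
    have hFc := hFle c hc
    simp only [hF] at hFc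
    have e1 : hcpSumS 3 c ^ 2 / (24 * hcpSumS 6 c) = hcpSumS 3 c ^ 2 / hcpSumS 6 c / 24 := by
      rw [div_div, mul_comm]
    have e2 : hcpSumS 3 c₀ ^ 2 / (24 * hcpSumS 6 c₀) = hcpSumS 3 c₀ ^ 2 / hcpSumS 6 c₀ / 24 := by
      rw [div_div, mul_comm]
    calc -(hcpSumS 3 c₀ ^ 2 / (24 * hcpSumS 6 c₀)) ≤ -(hcpSumS 3 c ^ 2 / (24 * hcpSumS 6 c)) := by
          rw [e1, e2]; linarith
      _ ≤ hcpE a (a * c) := hcpE_ge_shape ha hc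

end Summit.AtomisticToContinuum.Crystallization.Theorems.PalmGoodLaw.RelaxedRatio

end
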